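/-
Copyright (c) 2026. Released under the Apache 2.0 license.
-/
import Literature.NumberTheory.EllipticCurves.ManinConstantGamma1Gamma0Comparison
import HarnessLib

/-!
# The optimal `X₁(N)`-parametrisation maps the cusps over `∞` to RATIONAL points
# (Conrad–Edixhoven–Stein 2003, §6.1.2 / §6.2; Stevens 1989, §2)

Topic `Literature/NumberTheory/EllipticCurves`; namespace `Literature.NumberTheory.EllipticCurves.ModularForms`
(that of `Gamma1ParametrizationData`, `Gamma1ParametrizationData.IsOptimal`, `cuspSymbol`).  ONE named fact,
statement only; no definition of data, no theorem.

The source.  B. Conrad, B. Edixhoven, W. Stein, *`J₁(p)` has connected fibers*, Doc. Math. 8 (2003) 331–408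
(bib key `ConradEdixhovenStein2003`), §6.1.2, proof of Lemma 6.1.6 (p. 381), verbatim: "Let `X_μ(N)` be the
coarse moduli scheme over `ℤ` that classifies isomorphism classes of pairs `(E/S, α)`, with `α : μ_N ↪ E^{sm}` …
This is a smooth `ℤ`-curve … There is a canonical `ℤ`-point `∞ ∈ X_μ(N)(ℤ)` … the formal parameter `q` at the
`ℂ`-point `∞` computes the standard analytic `q`-expansion for weight-2 cusp forms on `Γ₁(N)`. The reason we
consider `X_μ(N)` rather than `X₁(N)` is simply because we want a smooth `ℤ`-model in which the analytic cusp `∞`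
descends to a `ℤ`-point. Let `φ : J₁(N) → A` be the Albanese quotient map over `ℚ`, and pass to Néron models over
`ℤ` … Since `X_μ(N)` is `ℤ`-smooth, there is a morphism `X_μ(N) → J₁(N)` over `ℤ` that extends the usual morphism
sending `∞` to `0`."; and §6.2 (p. 386), verbatim: "Due to how we defined `X₁(p)`, its `ℚ`-rational cusps are
exactly its cusps lying over the cusp `∞ ∈ X₀(p)(ℚ)`".  (At a general level `N` the cusps of `X_μ(N)` over
`∞ ∈ X₀(N)` are the translates `⟨d⟩∞` of the rational cusp `∞` under the diamond operators `⟨d⟩`,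
`d ∈ (ℤ/N)ˣ`, which are automorphisms over `ℚ`: `(E, α) ↦ (E, α ∘ [d])`; Diamond–Shurman, *A first course in
modular forms*, §7.7–7.9.)  G. Stevens, *Stickelberger elements and modular parametrizations of elliptic curves*,
Invent. Math. 98 (1989), §2 (bib key `Stevens1989`): the `X₁(N)`-optimal curve `E₁` of an isogeny class and its
parametrisation `X₁(N) → E₁` with connected kernel.

## What is transcribed, and how

The tree's `X₁(N)`-parametrisation vocabulary is analytic (`ManinConstantGamma1ModularDegree.lean`,
`ManinConstantGamma1Gamma0Comparison.lean`): a `Gamma1ParametrizationData W N` is the newform `f` of `W`, a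
Néron-type period pair `L` of the model `W` with its `℘`-uniformisation `uniformize : ℂ →+ W(ℂ)` (kernel `Λ_E`),
and the Manin constant `c ∈ ℤ` with `c Λ₁(f) ⊆ Λ_E`; the parametrisation is `τ ↦ uniformize (c · 2πi∫_{i∞}^τ f)`,
and `D.IsOptimal` (`Λ_E = c Λ₁(f)`) says that `W` is Stevens' `X₁(N)`-optimal curve `ℂ/Λ₁(f)` of its class (the
optimal quotient `A` of `J₁(N)` attached to `f`), on the given model.  Along `τ → γ∞` (`γ ∈ Γ₀(N)`) one has
`2πi∫_{i∞}^{γτ} f = {∞, γ∞}_f + 2πi∫_{i∞}^{τ} f` (`eichlerIntegral_smul_sub`), so the parametrisation extends over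
the cusp `γ∞` of `X₁(N)` — a cusp lying over `∞ ∈ X₀(N)` — with value `uniformize (c · {∞, γ∞}_f)`
(`cuspSymbol f γ = {∞, γ∞}_f`).  The printed statements (the morphism `X_μ(N) → A` is defined over `ℚ`, indeed
over `ℤ`, sends `∞` to `0`, and its analytic germ at `∞` is computed by the standard `q`-expansion; the cusps over
`∞` are `ℚ`-rational) give: THIS VALUE IS A `ℚ`-RATIONAL POINT of `W`.  (For an optimal datum on an arbitrary
model `W` of `A`: `W ≅ A` over `ℚ`, since `Λ_E` and the Néron lattice of `A` are rational multiples of `Λ₁(f)`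
with rational invariants `g₂, g₃`; the identification `A(ℂ) = ℂ/Λ₁(f)` is integration of `ω_f`, under which the
algebraic map is `τ ↦ ±c∫ω_f` because an analytic map of a compact Riemann surface to `ℂ/Λ` is determined by the
pull-back of `dz` and one value.)  Rendered, as the tree renders `exists_optimal_gamma1ParametrizationData`
(same file family), as a named fact over ALL optimal `X₁(N)`-data: `optimalGamma1Parametrization_cusp_rational`.

Consumers (cell bsd-f2-manin, crux C2 `ManinOddAtFour` of route `ManinLocalTwoThree`): with it the Shimura quotient
`Λ₀(f)/Λ₁(f)` (the kernel of the Shimura cover `E₁ → E₀`, `PeriodLatticeGamma1QuotientProofs.lean`) embeds in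
`E₁(ℚ)_tors`, which is the constancy half of «`Σ(N)` is of `μ`-type» (Ling–Oesterlé 1991, Thm. 1; Vatsal 2005,
Rem. 1.8) in the tree's lattice language
(`Summits/BirchSwinnertonDyer/BirchSwinnertonDyer/Theorems/ManinLocalTwoThreeShimuraQuotientRational.lean`).

NOT here: the `ℤ`-structure (extension to Néron models), the value at cusps NOT over `∞` (those are rational only
over `ℚ(μ_N)⁺`), non-optimal data (true as well, via a `ℚ`-isogeny from the optimal curve, but not transcribed),
and the `X₀(N)` analogue (cusps `a/c` of `X₀(N)` are rational iff `gcd(c, N/c) ∣ 2`).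

## References
* [ConradEdixhovenStein2003] B. Conrad, B. Edixhoven, W. Stein, Doc. Math. 8 (2003), §6.1.2 (proof of Lemma 6.1.6,
  p. 381) and §6.2 (p. 386).
* [Stevens1989] G. Stevens, Invent. Math. 98 (1989), §2.
* [DiamondShurman2005] F. Diamond, J. Shurman, GTM 228, §7.7–7.9 (`X₁(N)` over `ℚ`, diamond operators).
* [LingOesterle1991] S. Ling, J. Oesterlé, Astérisque 196–197 (1991), Thm. 1 (context: `Σ(N)` is of `μ`-type).
-/

noncomputable section

open scoped MatrixGroups ModularForm

open CongruenceSubgroup WeierstrassCurve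

namespace Literature.NumberTheory.EllipticCurves.ModularForms

/-- **The optimal `X₁(N)`-parametrisation maps the cusps over `∞` to rational points** (Conrad–Edixhoven–Stein
2003, §6.1.2, proof of Lemma 6.1.6, p. 381: "There is a canonical `ℤ`-point `∞ ∈ X_μ(N)(ℤ)` … Since `X_μ(N)` is
`ℤ`-smooth, there is a morphism `X_μ(N) → J₁(N)` over `ℤ` that extends the usual morphism sending `∞` to `0`",
composed with "the Albanese quotient map `φ : J₁(N) → A` over `ℚ`", and "the formal parameter `q` at the `ℂ`-point
`∞` computes the standard analytic `q`-expansion"; §6.2, p. 386: "its `ℚ`-rational cusps are exactly its cusps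
lying over the cusp `∞ ∈ X₀(p)(ℚ)`" — at any level the cusps over `∞` are the diamond translates `⟨d⟩∞`, rational
because the `⟨d⟩` are `ℚ`-automorphisms; Stevens 1989, §2: the `X₁(N)`-optimal curve).  Rendering (module
docstring): for an elliptic `W/ℚ` carrying an OPTIMAL `X₁(N)`-datum `D` (`D.IsOptimal`: `Λ_E = c · Λ₁(f)`, i.e. `W`
is Stevens' curve of its class on this model) and `γ ∈ Γ₀(N)`, the value of the parametrisation at the cusp `γ∞`,
namely `D.uniformize (c · {∞, γ∞}_f)`, is the base change to `ℂ` of a point of `W(ℚ)`.  Named fact (statement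
only). [cite: ConradEdixhovenStein2003, §6.1.2 proof of Lemma 6.1.6 (p. 381) and §6.2 (p. 386)] -/
def optimalGamma1Parametrization_cusp_rational : Prop :=
  ∀ (W : WeierstrassCurve ℚ) [W.IsElliptic] {N : ℕ} [NeZero N] (D : Gamma1ParametrizationData W N),
    D.IsOptimal → ∀ γ : Gamma0 N, ∃ P : (W.baseChange ℚ).toAffine.Point,
      Affine.Point.baseChange (W' := W) ℚ ℂ P = D.uniformize ((D.c : ℂ) * cuspSymbol D.f γ)

-- TODO(general form): the morphism `X_μ(N) → A` is defined over `ℤ` (Néron models), and non-optimal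
-- parametrisations `X₁(N) → E` (any `E` of the class) also map the cusps over `∞` into `E(ℚ)`.

end Literature.NumberTheory.EllipticCurves.ModularForms

end
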